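import Summits.QuantumFields.YangMills.Theorems.BalabanUVNodesN07Prop8StepTokenOfRecordSym152CprimeDprime
import Summits.QuantumFields.YangMills.Theorems.BalabanUVNodesN07SymBudgetRowClosure
import HarnessLib

/-!
# N07 [B11] (= [15] = [Balaban1985Variational]) Sect. F — MODULE 119: **THE GUARDED [15] PROP. 8 STEP TOKEN OF RECORD WITH THE K0 NUMERICS DISCHARGED** — 100⁵
# `…N07Prop8StepTokenOfRecordSym152CprimeDprime.prop8RegSepTopStepG_of_hThm4RecSym152PhiE_cprime_dprime` ✓p748785 ∘ MODULE 118 `…N07SymBudgetRowClosure.exists_numerics_budget_symPhiE`: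
# `Prop8RegSepTopStepG F N suppDom Adm B₃ a₀ a₁` (for SOME `B₃ ≥ 2L²`, `a₁ > 0`, at an `a₀ ∈ (0, a_max]`) from the structural rows, the ONE collar letter
# `32·sideP·C_H·B_H·e^{−δ_H ρ}·κ·L ≤ 1`, the conditional premise `HThm4RecSym152PhiE F N Mc ρ κ a₀ (ψc·(κ·ε)²)` and HSEAM — the twelve scalar guards, the seven `a₀`∕`a₁` guards,
# the per-level defect guards and the ONE closed-form budget row of 100⁵ are NO LONGER hypotheses

Cell `pub-ymgap`, seat `pub-ymgap-dag-n07-e` g31 (FAN-OUT §N07 row s3; LANE OWNER of the K0 road chart side).  `--kind proof --supports stmt-QuantumFields-20541 --as helper` (K0⁷);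
count-neutral; ONE theorem (0 `def`); composition by name.  [15] = [Balaban1985Variational]; [6] = [Balaban1985RegularSpaces]; [3] = [Balaban1985Averaging]; [I] = [Balaban1987RG1].

WHAT IS PROVED (sorry-free; axioms standard).  ★★★ `prop8RegSepTopStepG_of_hThm4RecSym152PhiE_closed (F N)` — the header's statement.  The consumer (the K0 witness of V22-Z stub 1
`Prop8StepCoPGridGAt`) chooses the integers of the structural rows, takes `κ := b9OfP F Mc ρ B₁` and `a_max := a0OfP …` from N05's (B′) road, the collar `ρ` above MODULE 118 §2's
threshold (`collar_letter_eventually`), receives `a₀ ≤ a_max` and transports the premise down by `hThm4RecSym152PhiE_mono`.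
WHAT REMAINS DISPLAYED, by name: (1) `HThm4RecSym152PhiE` ((c-ii)″ ✓p748560; N05's (B′) road — CONDITIONAL); (2) HSEAM = (R4) (the (ii)-docket: cell-form criticality on
`domainsOfSeq s.Ω k` from criticality on the `genSet s.Ω k` fibre — under the tree's inclusive `B15DeterminingSets.bondsOf` reading NOT derivable; the converse is 37a
`N07CritMultiScaleLamBond.isCritOnFibre_genSet_of_critLam`); (3) the collar letter and the structural integers.
HONEST LABEL (binding).  Count-neutral composition; nothing of [15]∕[6]∕[3] ANALYSIS asserted beyond the cited modules; NO stub registered or closed; K0⁷ ∕ K1⁹ NOT closed; N07 NOT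
discharged and NOT claimable; counts unmoved (typed 28∕28 · discharged 8∕28); one finite 𝕋⁴ programme at fixed ε — the route closes the conditional finite-𝕋⁴ rung `BalabanLadder.UV`
ONLY; the YM mass gap (Clay) is NOT proved by any of this; nothing continuum ∕ ℝ⁴ ∕ OS.  No `def`, no `instance`, no `notation`, no `sorry`.

References: [15] Prop. 8 p. 304, (144) p. 300, (147)–(163) pp. 301–304; [6] Thm. 4 p. 88, Prop. 6 (1.130)–(1.138) p. 99; [3] (26) p. 22, (78)–(81) p. 30; [I] (0.4), (0.11) p. 253.
-/

set_option autoImplicit false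

noncomputable section

open scoped BigOperators Matrix.Norms.L2Operator

namespace Summit.QuantumFields.YangMills.BalabanUVNodes.N07Prop8StepTokenOfRecordSym152Closed

open Literature.MathematicalPhysics.QuantumFieldTheory.Balaban1983to89
open Literature.MathematicalPhysics.QuantumFieldTheory.Balaban1983to89.Node00
open Literature.MathematicalPhysics.QuantumFieldTheory.Balaban1983to89.B15DeterminingSets
open T4Continuum (T4Family)
open GaugeField (gaugeAct)
open Summit.QuantumFields.YangMills.BalabanUVNodes.N07Thm4RecordStructureSym152PhiE (HThm4RecSym152PhiE)
open Summit.QuantumFields.YangMills.BalabanUVNodes.N07Prop8StepTokenOfRecordSym152ECprimeDprime (prop8RegSepTopStepG_of_hThm4RecSym152PhiE_cprime_dprime)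
open Summit.QuantumFields.YangMills.BalabanUVNodes.N07SymBudgetRowClosure (exists_numerics_budget_symPhiE)

set_option maxHeartbeats 1600000 in
open scoped Classical in
/-- ★★★ **THE [15] PROP. 8 STEP TOKEN OF RECORD WITH THE K0 NUMERICS DISCHARGED**: for every admissible collar datum (structural rows as in 100⁵) and every `κ > 0`, `ψc ≥ 0`,
`a_max > 0` with the collar letter `32·sideP·C_H·B_H·e^{−δ_H ρ}·κ·L ≤ 1`, there is `a₀ ∈ (0, a_max]` such that the conditional premise `HThm4RecSym152PhiE F N Mc ρ κ a₀ (ψc·(κ·ε)²)`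
and HSEAM yield `Prop8RegSepTopStepG F N suppDom Adm B₃ a₀ a₁` for some `B₃ ≥ 2L²`, `a₁ > 0` — 100⁵ ∘ MODULE 118 (`B₃ C θ Q a₀ a₁` chosen by `exists_numerics_budget_symPhiE`).
[cite: Balaban1985Variational, Prop. 8 p.304, (144) p.300, (147)–(163) pp.301–304; Balaban1985RegularSpaces, Thm. 4 p.88, Prop. 6 (1.130)–(1.138) p.99; Balaban1985Averaging, (26) p.22, (78)–(81) p.30; Balaban1987RG1, (0.4), (0.11) p.253] -/
theorem prop8RegSepTopStepG_of_hThm4RecSym152PhiE_closed (F : T4Family) (N : ℕ) [NeZero N] :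
    ∃ (Mh₀ R₀ : ℕ) (CH δH BH : ℝ), 0 ≤ CH ∧ 0 < δH ∧ 0 < BH ∧
    ∀ {ρ : ℕ}
      {Mc Mh R a' : ℕ} (_ : 1 ≤ Mc) (_ : Mc ≤ ρ) (_ : Mh = F.L ^ a') (_ : Mh₀ ≤ Mh) (_ : R₀ ≤ R) (_ : F.L * Mh ∣ ρ) (_ : R * (F.L * Mh) ≤ ρ) (hLρ : F.L ≤ ρ)
      (_ : 2 * F.L ≤ R * (F.L * Mh) + 1)
      {c c₀ : ℕ} (_ : (11 * 4 + 4 * ρ + Mc + 3) * F.L ≤ c) (_ : Mc + 11 * 4 + 6 * ρ + 1 ≤ 2 * F.L ^ c₀) (_ : F.m ≤ c₀) (_ : a' + 3 ≤ c₀)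
      (Adm : StepGuard F) (_ : ∀ (ν : Stage7Numerics) (M : ℕ) (g : ℕ → ℝ) (K k : ℕ) (s : SeqOfRecord F ν M g K k), Adm ν M g K k s → c ≤ ν.M₁ ∧ k + c₀ ≤ F.m + K)
      (_ : ∀ (ν : Stage7Numerics) (M : ℕ) (g : ℕ → ℝ) (K k : ℕ) (s : SeqOfRecord F ν M g K k), Adm ν M g K k s → ∀ j : ℕ, 1 ≤ j → j ≤ k →
        F.L * Mh ∣ M * RkOfRecord (F.P K).L ν.r (g j) ∧ dCubeSide (F.P K).L M (RkOfRecord (F.P K).L ν.r (g j)) j ∣ (F.P K).sitesPerDir 0)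
      {κ ψc amax : ℝ} (_ : 0 < κ) (_ : 0 ≤ ψc) (_ : 0 < amax)
      -- ★ THE COLLAR LETTER (⚑ LOCATED-COLLAR-THRESHOLD; MODULE 118 §2 supplies it for every large `ρ`)
      (_ : 32 * ((sideP (F.P 0) Mc ρ : ℕ) : ℝ) * CH * BH * Real.exp (-(δH * (ρ : ℝ))) * (κ * (F.L : ℝ)) ≤ 1),
      ∃ a₀ : ℝ, 0 < a₀ ∧ a₀ ≤ amax ∧
      -- ★ THE ONE CONDITIONAL PREMISE OF RECORD ((c-ii)″), at the chosen `a₀`, defect `Ψ ε j := ψc·(κ·ε_j)²`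
      ∀ (_ : HThm4RecSym152PhiE F N Mc ρ κ a₀ (fun ε j => ψc * (κ * ε j) ^ 2))
      -- ★ HSEAM = (R4) — displayed, NOT discharged
      (_ : ∀ (ν : Stage7Numerics) (M : ℕ) (g : ℕ → ℝ) (K k : ℕ) (s : SeqOfRecord F ν M g K k), Sect2.SeqSeparated ν.M₁ s → 0 < ν.M₁ →
        Adm ν M g K k s → 1 ≤ k →
        ∀ (δ : ℕ → ℝ),
        ∀ W : MSField (F.P K) (SU N), Sect2.DataSmall7PTop (avOfRecord F N K) s.Ω (suppDomOfRecord F ν K s.Ω) k δ W →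
        ∀ U : GaugeField (F.P K) 0 (SU N),
        AgreeOn (genSet s.Ω k) (avgFamily (avOfRecord F N K) U) W → IsCritOnFibre F N K (genSet s.Ω k) W U →
        ∀ (hkk : k ≤ (F.P K).m + (F.P K).K),
        ∀ γ : ℝ → GaugeField (F.P K) 0 (SU N), γ 0 = U →
          DifferentiableAt ℝ (fun (t : ℝ) (b : PBond (F.P K) 0) => ((γ t b : SU N) : Matrix (Fin N) (Fin N) ℂ)) 0 →
            (∀ᶠ t in nhds (0 : ℝ), ∀ (j : ℕ) (c : PBond (F.P K) j), (domainsOfSeq s.Ω k hkk).LamBond j c →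
              avgFamily (avOfRecord F N K) (γ t) j c = W j c) →
              ∀ a : ℝ, HasDerivAt (fun t => wilsonAction4 (γ t)) a 0 → a = 0),
      ∃ B₃ a₁ : ℝ, 2 * (F.L : ℝ) ^ 2 ≤ B₃ ∧ 0 < a₁ ∧ Prop8RegSepTopStepG F N (fun ν K Ω => suppDomOfRecord F ν K Ω) Adm B₃ a₀ a₁ := by
  obtain ⟨Mh₀, R₀, CH, δH, BH, C₁, τ, hCH, hδH, hBH, hC₁, hτ, hmain⟩ := prop8RegSepTopStepG_of_hThm4RecSym152PhiE_cprime_dprime F N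
  refine ⟨Mh₀, R₀, CH, δH, BH, hCH, hδH, hBH, ?_⟩
  intro ρ Mc Mh R a' hMc hMcρ hMha hMh hR hdvd hRρ hLρ hRM c c₀ hc hc₀ hmc₀ hac₀ Adm hAdm₁ hAdm₂ κ ψc amax hκ hψc hamax hcollar
  obtain ⟨B₃, C, θ, Q, a₀, a₁, hB₃, hC0, hθ0, hQ0, ha₀, haamax, ha₁, hB₃L, hC, hθ, ha, hκa, hκτ, ha₀bud, ha₀gd, ha₀σF, ha₀σS, ha₀σ4, hguard, hguardF, hΨ, hbudget⟩ :=
    exists_numerics_budget_symPhiE F N Mc ρ hκ hψc hCH hBH hC₁ hτ hamax hcollar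
  refine ⟨a₀, ha₀, haamax, fun hT hseam => ⟨B₃, a₁, hB₃L, ha₁, ?_⟩⟩
  exact hmain hMc hMcρ hMha hMh hR hdvd hRρ hLρ hRM hc hc₀ hmc₀ hac₀ Adm hAdm₁ hAdm₂ hB₃ hC0 hθ0 hQ0 hκ hB₃L hC hθ ha hκa hκτ ha₀bud ha₀gd ha₀σF ha₀σS ha₀σ4
    hguard hguardF hΨ hbudget hT hseam

end Summit.QuantumFields.YangMills.BalabanUVNodes.N07Prop8StepTokenOfRecordSym152Closed

end
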